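import Summits.BirchSwinnertonDyer.Rank1Residual.X2.ClassClosureO9RiemannSumLevelBound
import Summits.BirchSwinnertonDyer.Rank1Residual.X4.OptimalPeriod
import Literature.NumberTheory.EllipticCurves.AgasheRibetStein2006.ManinConstantOptimalCurves
import Literature.NumberTheory.EllipticCurves.SkinnerUrban2014.PAdicUnitPeriodRatioProofs
import HarnessLib

/-!
# O9 (X2c), NON-SPLIT sub-cell: the Riemann-sum certificate IN THE ENGINES' CURRENCY — the
# Néron-normalised symbol of the OPTIMAL member differs from `[·]⁺_f` by a `p`-adic UNIT, so the
# period ratio `ϖ = Ω⁺_f/Ω_E` of the lane's link (α) is discharged for the curve the engines ran on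
# (cell `b2b-bsdres`, lane CLASS-CLOSURE, seat `cc-typer-6` GEN 11, O9 typer of record; theorems
# only — no definition, no named fact, nothing booked)

HONEST FRAMING (run/shared/lean/b2b/bsd-rank1-residual/, verbatim in every file): the goal of the
cell is to DELETE the COMBINATION-SHAPED residual classes of the Birch–Swinnerton-Dyer formula for
ALL analytic-rank `≤ 1` elliptic curves over `ℚ` — "full BSD formula for every rank `≤ 1` curve in
class `C`" assembled STRICTLY from published theorems — so that the rank-`≤ 1` remainder becomes
exactly the CONSTRUCTION-SHAPED classes, which are TYPED (missing-input `Prop`s), NOT attempted.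
This is not "finishing BSD". Lane CLASS-CLOSURE: research routes; no claim beyond the stated classes;
census / instrument output is EVIDENCE, never a Literature fact; per-pair certificates are
INSTRUMENTATION (E4), never coverage. Every published theorem enters as one of the tree's named
Literature facts BY NAME; nothing about any particular curve is asserted; no label changes; X2c stays
CONSTRUCTION-SHAPED until referee A rules.

## What this file records (the (α) step of the O9 certificate road)

After `ClassClosureO9RiemannSumLevelBound` (p291694) the per-pair input of the non-split Greenberg–
Vatsal sub-cell `X2.CellCNonsplitGV W p` is ONE inequality `p⁻ⁿ < ‖RS 1 n‖` on an exact finite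
Riemann sum of the rational plus symbols `[a/pᵐ]⁺_f = ratPlusSymbol f (a/pᵐ)` of the newform `f`
of `W` — the TREE's currency, normalised by the period `Ω⁺_f = plusPeriod f` of `f`. The lane's
symbol engines (cc-eng-6's route K = PARI `msfromell`; ENG-D; iw-1's engines A2/B) print instead the
Néron-normalised symbol of the curve they are given, i.e. (cc-eng-6 `eng-6/n8-mu/INSTANTIATION-NOTE.md`
§1, the lane's ONE stated-not-typed link (α)) a function `x : ℚ → ℚ` with
`x r = κ · ϖ · [r]⁺_f` for all `r`, where `ϖ · Ω(W) = Ω⁺_f` and `κ = ±2ᵏ` (component factor, the `½`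
of the plus symbol, path orientation; a `p`-adic unit at odd `p`). census-ctyper-2 GEN 19
(`census/…/MUSPEC-TYPER-CHECK.md`, HOME/INBOX 2026-08-21T17:26Z §8) observed that the INEQUALITY
clause is stated on the bare tree sum, so an engine row instantiates it only up to `‖ϖ‖_p`, and that
on O9 (`E[p]` REDUCIBLE: rational `p`-isogenies inside the class) `Ω` — hence `ϖ` — changes by powers
of `p` across the isogeny class, so `‖ϖ‖_p = 1` is a statement about the MEMBER the engine ran on.
The tree's period-unit theorems (`SkinnerUrban2014/PAdicUnitPeriodRatioProofs`: `Ω(W) = u·Ω⁺_f`,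
`‖u‖_p = 1`) all assume `E[p]` irreducible and are unavailable here.

This file proves the reducible-case replacement, member by member, from theorems already in the
tree (`X4/OptimalPeriod`: `Ω(W) = |c|·Ω⁺_f` EXACTLY for a lattice-OPTIMAL parametrisation datum,
`Λ_E = c·Λ_f`, Cremona §2.8 / Edixhoven 1991 §1):

* `exists_riemannSumNonsplit_eq_mul`, `riemannSumNonsplit_eq_mul_of_symbol_eq_mul` — bookkeeping:
  if `x = c·[·]⁺_f` pointwise then every signed Riemann sum of `x` is `c` times that of `[·]⁺_f`.
* `norm_ratCast_varpi_eq_one_of_optimal` — **for the OPTIMAL member** (`W` globally minimal carrying a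
  lattice-optimal datum `D` at level `N`, i.e. `W` is a minimal model of the strong Weil curve `E_f`)
  **with `p ∤ c`: every `ϖ` with `ϖ·Ω(W) = Ω⁺_f` is a `p`-adic unit** — NO hypothesis on `E[p]`;
  `varpi_eq_one_of_optimal_of_abs_maninConstant_eq_one` — if moreover `|c| = 1` then `ϖ = 1`
  (so the engines' symbol IS `±2ᵏ·[·]⁺_f`).
* `norm_riemannSumNonsplit_eq_of_optimal` — hence `‖RSx k n‖ = ‖RS k n‖`: on the optimal member
  the engine-currency and tree-currency Riemann sums have the same valuation, index by index.
* **`bsdp_of_cellCNonsplitGV_of_optimal_of_thm1_of_neronRiemannSum_lt`** — `X2.CellCNonsplitGV W p`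
  ∧ `W` carries a lattice-optimal datum with `p ∤ c` ∧ ONE inequality `p⁻ⁿ < ‖RSx 1 n‖` on the
  ENGINE-currency signed Riemann sum ⟹ `BSD(E,p)` (published named facts of p291694: A183 `hD`;
  GV00 at `p ‖ N` `hGV`, flag `GV00-mult-asserted`; Wuthrich Thm. 16 `hWu`; SW Thm. 6.1 `hJn`,
  §4.2 existence `hHn`; GZK; modularity `hpar`); the variants `…_of_level_le` (the Manin constant
  input from the named fact `AgasheRibetStein2006.cremona_abs_maninConstant_eq_one_of_level_le`,
  Agashe–Ribet–Stein 2006 Thm. 2.6 / appendix Thm. 5.2 (Cremona), `N ≤ 130000`) and `…_of_mazur`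
  (from `mazur_not_dvd_maninConstant_of_odd`, Mazur 1978 Cor. 4.1: odd `p`, `p² ∤ N` — automatic at
  a multiplicative prime — ANY conductor); and the Mazur-main-conjecture twin
  `bsdp_of_cellC_of_not_split_of_mazurMainConjectureAt_of_optimal_of_thm1_of_neronRiemannSum_lt`
  for the other parity (`X2.CellCNonsplitNotGV`, route G per pair).
* The sibling `X2/ClassClosureO9IsogenousMemberRiemannSum.lean` treats an ARBITRARY member joined to
  the optimal one by a `ℚ`-isogeny of degree `d` (`|ord_p ϖ| ≤ ord_p d`; the inequality must then be
  won by the extra factor `‖d‖_p⁻¹`).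

READING for the lane (EVIDENCE bookkeeping, nothing booked): for a census row whose curve is the one
numbered `1` of a Cremona class of conductor `N < 60000` (all 749 O9 window rows, none is `990h`),
"`W` carries a lattice-optimal datum with `|c| = 1`" is Agashe–Ribet–Stein 2006, appendix Thm. 5.2
(Cremona) — a PUBLISHED theorem (registered instances: A55 / A69 / A93) — so after this file the link
(α) retains NO period content: what is left is the instrument's own specification `hx` (which
function the engine tabulates), carried as the labelled hypothesis it always was. CONDITIONAL
theorems; no count moves; the split residue `X2.O9.ExceptionalLeadingTermAt` is untouched.

References: [AgasheRibetStein2006] Thm. 2.6, appendix Thm. 5.2 (p. 633); [Mazur1978] Cor. 4.1;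
[EdixhovenManin1991] Prop. 2, §1; [CremonaAlgorithms1997] §2.8 (p. 26), §2.10;
[GreenbergVatsal2000] §3 Rem. 3.4, Thm. (1.3); [Disegni2020] Thm. 1 (§1.2);
[MazurTateTeitelbaum1986Invent] §I.4 (4.2), §I.8, §I.10, §I.13; [SteinWuthrich2013] §3, §4.2, Thm. 6.1;
[Wuthrich2014] Thm. 16; [SilvermanAEC2009] Thm. VI.4.1 (b).
-/

set_option autoImplicit false

noncomputable section

open scoped Classical MatrixGroups ModularForm

open CongruenceSubgroup WeierstrassCurve Literature.NumberTheory.EllipticCurves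
  Literature.NumberTheory.EllipticCurves.ModularForms
  Literature.NumberTheory.EllipticCurves.Rank1Residual
  Literature.NumberTheory.EllipticCurves.Rank1Residual.Typed
  Literature.NumberTheory.EllipticCurves.GreenbergVatsal2000
  Literature.NumberTheory.EllipticCurves.Wuthrich2014
  Literature.NumberTheory.EllipticCurves.SteinWuthrich2013
  Literature.NumberTheory.EllipticCurves.Disegni2020
  Literature.NumberTheory.EllipticCurves.AgasheRibetStein2006
  Literature.NumberTheory.EllipticCurves.SkinnerUrban2014

namespace Summit.BirchSwinnertonDyer.Rank1Residual.X2

variable (W : WeierstrassCurve ℚ) [W.IsElliptic] [W.IsGloballyMinimal] (p : ℕ) [Fact p.Prime]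

/-! ### §1. Bookkeeping: a scaled symbol has scaled Riemann sums -/

section Scaling

variable {p}

omit [W.IsElliptic] [W.IsGloballyMinimal] in
/-- **Scaled symbol, scaled signed Riemann sums (existential form).** If `x r = c · [r]⁺_f` for all
`r`, then the signed (non-split) Riemann sums `RSx` of `x` — the sums of `Iwasawa.RiemannSumUnitCertAt`
/ `X2.bsdp_of_cellC_of_not_split_of_gvPar_of_thm1_of_riemannSum_lt` with `x` in place of
`ratPlusSymbol f` — are `c` times the sums `RS` of `[·]⁺_f`, index by index. [folklore] -/
theorem exists_riemannSumNonsplit_eq_mul {N : ℕ} [NeZero N] (f : CuspForm (Gamma0 N) 2)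
    {x : ℚ → ℚ} {c : ℚ} (hx : ∀ r, x r = c * ratPlusSymbol f r) {RSx : ℕ → ℕ → ℚ_[p]}
    (hRSx : ∀ k n : ℕ, RSx k n =
      ∑ᶠ ξ : rootsOfUnity (torsionOrder p) ℤ_[p], ∑ s : ZMod (p ^ n),
        (fun (n : ℕ) (a : ZMod (p ^ n)) ↦
            (-1 : ℚ_[p]) ^ n * (x ((a.val : ℚ) / (p : ℚ) ^ n) : ℚ_[p]))
          (n + cyclotomicExponent p)
            (PadicInt.toZModPow (n + cyclotomicExponent p) ((ξ : ℤ_[p]ˣ) : ℤ_[p]) *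
              (cyclotomicGenerator p : ZMod (p ^ (n + cyclotomicExponent p))) ^ s.val) *
          ((s.val.choose k : ℕ) : ℚ_[p])) :
    ∃ RS : ℕ → ℕ → ℚ_[p],
      (∀ k n : ℕ, RS k n =
        ∑ᶠ ξ : rootsOfUnity (torsionOrder p) ℤ_[p], ∑ s : ZMod (p ^ n),
          (fun (n : ℕ) (a : ZMod (p ^ n)) ↦
              (-1 : ℚ_[p]) ^ n * (ratPlusSymbol f ((a.val : ℚ) / (p : ℚ) ^ n) : ℚ_[p]))
            (n + cyclotomicExponent p)
              (PadicInt.toZModPow (n + cyclotomicExponent p) ((ξ : ℤ_[p]ˣ) : ℤ_[p]) *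
                (cyclotomicGenerator p : ZMod (p ^ (n + cyclotomicExponent p))) ^ s.val) *
            ((s.val.choose k : ℕ) : ℚ_[p])) ∧
      ∀ k n : ℕ, RSx k n = ((c : ℚ) : ℚ_[p]) * RS k n := by
  refine ⟨fun k n ↦
      ∑ᶠ ξ : rootsOfUnity (torsionOrder p) ℤ_[p], ∑ s : ZMod (p ^ n),
        (fun (n : ℕ) (a : ZMod (p ^ n)) ↦
            (-1 : ℚ_[p]) ^ n * (ratPlusSymbol f ((a.val : ℚ) / (p : ℚ) ^ n) : ℚ_[p]))
          (n + cyclotomicExponent p)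
            (PadicInt.toZModPow (n + cyclotomicExponent p) ((ξ : ℤ_[p]ˣ) : ℤ_[p]) *
              (cyclotomicGenerator p : ZMod (p ^ (n + cyclotomicExponent p))) ^ s.val) *
          ((s.val.choose k : ℕ) : ℚ_[p]),
    fun _ _ ↦ rfl, fun k n ↦ ?_⟩
  haveI := neZero_torsionOrder p
  haveI := Fintype.ofFinite (rootsOfUnity (torsionOrder p) ℤ_[p])
  rw [hRSx]
  simp only [finsum_eq_sum_of_fintype, Finset.mul_sum, hx, Rat.cast_mul]
  refine Finset.sum_congr rfl fun ξ _ ↦ Finset.sum_congr rfl fun s _ ↦ ?_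
  ring

omit [W.IsElliptic] [W.IsGloballyMinimal] in
/-- **Scaled symbol, scaled signed Riemann sums.** With `x r = c · [r]⁺_f` and `RSx`, `RS` the signed
Riemann sums of `x` and of `[·]⁺_f`: `RSx k n = c · RS k n`. [folklore] -/
theorem riemannSumNonsplit_eq_mul_of_symbol_eq_mul {N : ℕ} [NeZero N] (f : CuspForm (Gamma0 N) 2)
    {x : ℚ → ℚ} {c : ℚ} (hx : ∀ r, x r = c * ratPlusSymbol f r) {RSx RS : ℕ → ℕ → ℚ_[p]}
    (hRSx : ∀ k n : ℕ, RSx k n =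
      ∑ᶠ ξ : rootsOfUnity (torsionOrder p) ℤ_[p], ∑ s : ZMod (p ^ n),
        (fun (n : ℕ) (a : ZMod (p ^ n)) ↦
            (-1 : ℚ_[p]) ^ n * (x ((a.val : ℚ) / (p : ℚ) ^ n) : ℚ_[p]))
          (n + cyclotomicExponent p)
            (PadicInt.toZModPow (n + cyclotomicExponent p) ((ξ : ℤ_[p]ˣ) : ℤ_[p]) *
              (cyclotomicGenerator p : ZMod (p ^ (n + cyclotomicExponent p))) ^ s.val) *
          ((s.val.choose k : ℕ) : ℚ_[p]))
    (hRS : ∀ k n : ℕ, RS k n =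
      ∑ᶠ ξ : rootsOfUnity (torsionOrder p) ℤ_[p], ∑ s : ZMod (p ^ n),
        (fun (n : ℕ) (a : ZMod (p ^ n)) ↦
            (-1 : ℚ_[p]) ^ n * (ratPlusSymbol f ((a.val : ℚ) / (p : ℚ) ^ n) : ℚ_[p]))
          (n + cyclotomicExponent p)
            (PadicInt.toZModPow (n + cyclotomicExponent p) ((ξ : ℤ_[p]ˣ) : ℤ_[p]) *
              (cyclotomicGenerator p : ZMod (p ^ (n + cyclotomicExponent p))) ^ s.val) *
          ((s.val.choose k : ℕ) : ℚ_[p]))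
    (k n : ℕ) : RSx k n = ((c : ℚ) : ℚ_[p]) * RS k n := by
  obtain ⟨RS', hRS', hscale⟩ := exists_riemannSumNonsplit_eq_mul (p := p) f hx hRSx
  rw [hscale k n, hRS' k n, ← hRS k n]

end Scaling

/-! ### §2. The optimal member: `ϖ` is a `p`-adic unit (no hypothesis on `E[p]`) -/

section Optimal

variable {W p} {N : ℕ} [NeZero N]

omit [W.IsGloballyMinimal] in
/-- **On the optimal member, `ϖ` is a `p`-adic unit.** Let `W/ℚ` be an elliptic curve carrying a
lattice-OPTIMAL parametrisation datum `D` at level `N` (`Λ_E = c·Λ_f`: `W` is a model of the strong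
Weil curve `E_f`, `c` its Manin constant — the rendering used by the tree's Manin facts), and let
`p ∤ c`. Then every `ϖ ∈ ℚ` with `ϖ·Ω(W) = Ω⁺_f` has `‖ϖ‖_p = 1`: indeed `Ω(W) = |c|·Ω⁺_f`
(`X4.realPeriodRat_eq_abs_maninConstant_mul_plusPeriod_of_optimal`), so `ϖ = 1/|c|`. No hypothesis on
the mod-`p` representation (the reducible O9 case included). [cite: CremonaAlgorithms1997, §2.8 (p. 26)]
[cite: EdixhovenManin1991, §1] -/
theorem norm_ratCast_varpi_eq_one_of_optimal (D : ModularParametrizationData W N)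
    (hopt : ∀ z ∈ D.L.lattice, ∃ w ∈ periodLattice D.f, z = D.c * w)
    (hcp : ¬ (p : ℤ) ∣ D.maninConstant) {ϖ : ℚ}
    (hϖ : (ϖ : ℝ) * W.realPeriodRat = plusPeriod D.f) : ‖((ϖ : ℚ) : ℚ_[p])‖ = 1 := by
  obtain ⟨u, hu, hΩ⟩ := X4.periodTransfer_of_optimal p D hopt hcp
  have hpos : 0 < plusPeriod D.f :=
    IsNewform0.plusPeriod_pos_holds D.isNewformOf.1 D.isNewformOf.coeffField_eq_bot
  have h1 : ((ϖ * u : ℚ) : ℝ) = 1 := by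
    have h : (ϖ : ℝ) * u * plusPeriod D.f = 1 * plusPeriod D.f := by
      rw [mul_assoc, ← hΩ, hϖ, one_mul]
    push_cast
    exact mul_right_cancel₀ hpos.ne' h
  have h2 : ϖ * u = 1 := by exact_mod_cast h1
  have h3 : ((ϖ : ℚ) : ℚ_[p]) * ((u : ℚ) : ℚ_[p]) = 1 := by
    rw [← Rat.cast_mul, h2, Rat.cast_one]
  have h4 : ‖((ϖ : ℚ) : ℚ_[p])‖ * ‖((u : ℚ) : ℚ_[p])‖ = 1 := by rw [← norm_mul, h3, norm_one]
  rwa [hu, mul_one] at h4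

omit [W.IsGloballyMinimal] in
/-- **On the optimal member with Manin constant `±1`, `ϖ = 1` exactly**: `Ω(W) = Ω⁺_f`, so the
Néron-normalised symbol of `W` IS `[·]⁺_f` up to the component/orientation factor `±2ᵏ`. For the
curve numbered `1` of a Cremona class of conductor `< 60000` the two hypotheses are Agashe–Ribet–Stein
2006, appendix Thm. 5.2 (Cremona). [cite: AgasheRibetStein2006, Thm. 2.6 and appendix Thm. 5.2 (p. 633)]
[cite: CremonaAlgorithms1997, §2.8 (p. 26)] -/
theorem varpi_eq_one_of_optimal_of_abs_maninConstant_eq_one (D : ModularParametrizationData W N)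
    (hopt : ∀ z ∈ D.L.lattice, ∃ w ∈ periodLattice D.f, z = D.c * w)
    (h1 : |D.maninConstant| = 1) {ϖ : ℚ}
    (hϖ : (ϖ : ℝ) * W.realPeriodRat = plusPeriod D.f) : ϖ = 1 := by
  have hΩ := X4.realPeriodRat_eq_abs_maninConstant_mul_plusPeriod_of_optimal D hopt
  have habs : |(D.c : ℝ)| = 1 := by
    have h : ((|D.c| : ℤ) : ℝ) = 1 := by exact_mod_cast h1
    rwa [Int.cast_abs] at h
  have hpos : 0 < plusPeriod D.f :=
    IsNewform0.plusPeriod_pos_holds D.isNewformOf.1 D.isNewformOf.coeffField_eq_bot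
  rw [habs, one_mul] at hΩ
  rw [hΩ] at hϖ
  have h : (ϖ : ℝ) * plusPeriod D.f = 1 * plusPeriod D.f := by rw [hϖ, one_mul]
  exact_mod_cast mul_right_cancel₀ hpos.ne' h

omit [W.IsGloballyMinimal] in
/-- **Engine currency = tree currency in norm, on the optimal member.** If the engine tabulates
`x r = κ·ϖ·[r]⁺_f` (`‖κ‖_p = 1`, `ϖ·Ω(W) = Ω⁺_f`) for the OPTIMAL member `W` with `p ∤ c`, then its
signed Riemann sums have the same `p`-adic norm as the tree's: `‖RSx k n‖ = ‖RS k n‖` for all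
`k, n`. [folklore] -/
theorem norm_riemannSumNonsplit_eq_of_optimal (D : ModularParametrizationData W N)
    (hopt : ∀ z ∈ D.L.lattice, ∃ w ∈ periodLattice D.f, z = D.c * w)
    (hcp : ¬ (p : ℤ) ∣ D.maninConstant) {x : ℚ → ℚ} {κ ϖ : ℚ} (hκ : ‖((κ : ℚ) : ℚ_[p])‖ = 1)
    (hϖ : (ϖ : ℝ) * W.realPeriodRat = plusPeriod D.f)
    (hx : ∀ r, x r = κ * ϖ * ratPlusSymbol D.f r) {RSx RS : ℕ → ℕ → ℚ_[p]}
    (hRSx : ∀ k n : ℕ, RSx k n =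
      ∑ᶠ ξ : rootsOfUnity (torsionOrder p) ℤ_[p], ∑ s : ZMod (p ^ n),
        (fun (n : ℕ) (a : ZMod (p ^ n)) ↦
            (-1 : ℚ_[p]) ^ n * (x ((a.val : ℚ) / (p : ℚ) ^ n) : ℚ_[p]))
          (n + cyclotomicExponent p)
            (PadicInt.toZModPow (n + cyclotomicExponent p) ((ξ : ℤ_[p]ˣ) : ℤ_[p]) *
              (cyclotomicGenerator p : ZMod (p ^ (n + cyclotomicExponent p))) ^ s.val) *
          ((s.val.choose k : ℕ) : ℚ_[p]))
    (hRS : ∀ k n : ℕ, RS k n =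
      ∑ᶠ ξ : rootsOfUnity (torsionOrder p) ℤ_[p], ∑ s : ZMod (p ^ n),
        (fun (n : ℕ) (a : ZMod (p ^ n)) ↦
            (-1 : ℚ_[p]) ^ n * (ratPlusSymbol D.f ((a.val : ℚ) / (p : ℚ) ^ n) : ℚ_[p]))
          (n + cyclotomicExponent p)
            (PadicInt.toZModPow (n + cyclotomicExponent p) ((ξ : ℤ_[p]ˣ) : ℤ_[p]) *
              (cyclotomicGenerator p : ZMod (p ^ (n + cyclotomicExponent p))) ^ s.val) *
          ((s.val.choose k : ℕ) : ℚ_[p]))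
    (k n : ℕ) : ‖RSx k n‖ = ‖RS k n‖ := by
  have hϖ1 := norm_ratCast_varpi_eq_one_of_optimal D hopt hcp hϖ
  rw [riemannSumNonsplit_eq_mul_of_symbol_eq_mul (p := p) D.f hx hRSx hRS k n, norm_mul,
    Rat.cast_mul, norm_mul, hκ, hϖ1, one_mul, one_mul]

end Optimal

/-! ### §3. The O9 non-split consumers in the engines' currency, on the optimal member -/

section Consumers

variable {N : ℕ} [NeZero N] (D : ModularParametrizationData W N) {x : ℚ → ℚ} {κ ϖ : ℚ}
  {RSx : ℕ → ℕ → ℚ_[p]}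
  (hRSx : ∀ k n : ℕ, RSx k n =
      ∑ᶠ ξ : rootsOfUnity (torsionOrder p) ℤ_[p], ∑ s : ZMod (p ^ n),
        (fun (n : ℕ) (a : ZMod (p ^ n)) ↦
            (-1 : ℚ_[p]) ^ n * (x ((a.val : ℚ) / (p : ℚ) ^ n) : ℚ_[p]))
          (n + cyclotomicExponent p)
            (PadicInt.toZModPow (n + cyclotomicExponent p) ((ξ : ℤ_[p]ˣ) : ℤ_[p]) *
              (cyclotomicGenerator p : ZMod (p ^ (n + cyclotomicExponent p))) ^ s.val) *
          ((s.val.choose k : ℕ) : ℚ_[p]))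

include hRSx

/-- **Sub-cell `X2.CellCNonsplitGV` ∧ OPTIMAL member ∧ ONE engine-currency Riemann sum ⟹ `BSD(E,p)`.**
p291694's `bsdp_of_cellC_of_not_split_of_gvPar_of_thm1_of_riemannSum_lt` with the inequality read on
the ENGINES' signed Riemann sum `RSx` of the Néron-normalised symbol `x = κ·ϖ·[·]⁺_f` (`‖κ‖_p = 1`,
`ϖ·Ω(W) = Ω⁺_f` — the lane's link (α), here a HYPOTHESIS `hx` on what the instrument tabulates), for
`W` the OPTIMAL member (lattice-optimal datum `D`, `p ∤ c`): `‖RSx 1 n‖ = ‖RS 1 n‖`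
(`norm_riemannSumNonsplit_eq_of_optimal`). PUBLISHED named facts (A183 `hD`; GV00 at `p ‖ N` `hGV`,
flag `GV00-mult-asserted`; Wuthrich Thm. 16 `hWu`; SW Thm. 6.1 `hJn`, §4.2 existence `hHn`; GZK;
modularity `hpar`) + the per-pair inequality. CONDITIONAL; nothing booked; X2c stays
CONSTRUCTION-SHAPED. [cite: Disegni2020, Thm. 1 (§1.2)] [cite: GreenbergVatsal2000, Thm. (1.3) with pp. 1, 14–15]
[cite: Wuthrich2014, Thm. 16 (p. 397)] [cite: SteinWuthrich2013, Thm. 6.1 (p. 20), §3, §4.2]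
[cite: CremonaAlgorithms1997, §2.8 (p. 26)] -/
theorem bsdp_of_cellCNonsplitGV_of_optimal_of_thm1_of_neronRiemannSum_lt
    (hD : thm1_padicBSD_rankOne_multiplicative) (hGV : lambdaMu_multiplicative_of_gvPar)
    (hWu : thm16_charIdeal_dvd_multiplicative_of_reducible) (hJn : thm61_nonsplitMultiplicative)
    (hHn : exists_isMultCanonical) (hGZK : rank_eq_analyticRank_of_analyticRank_le_one)
    (hpar : nonempty_modularParametrizationData) (hc : CellCNonsplitGV W p)
    (hopt : ∀ z ∈ D.L.lattice, ∃ w ∈ periodLattice D.f, z = D.c * w)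
    (hcp : ¬ (p : ℤ) ∣ D.maninConstant) (hκ : ‖((κ : ℚ) : ℚ_[p])‖ = 1)
    (hϖ : (ϖ : ℝ) * W.realPeriodRat = plusPeriod D.f) (hx : ∀ r, x r = κ * ϖ * ratPlusSymbol D.f r)
    {n : ℕ} (hlt : (p : ℝ) ^ (-n : ℤ) < ‖RSx 1 n‖) : BSDp W p := by
  obtain ⟨RS, hRS, -⟩ := exists_riemannSumNonsplit_eq_mul (p := p) D.f hx hRSx
  have hnorm : ‖RSx 1 n‖ = ‖RS 1 n‖ :=
    norm_riemannSumNonsplit_eq_of_optimal D hopt hcp hκ hϖ hx hRSx hRS 1 n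
  rw [hnorm] at hlt
  exact bsdp_of_cellC_of_not_split_of_gvPar_of_thm1_of_riemannSum_lt W p D hRS hD hGV hWu hJn hHn
    hGZK hpar hc hlt

/-- **The same, with the Manin constant from Agashe–Ribet–Stein 2006** (named fact
`AgasheRibetStein2006.cremona_abs_maninConstant_eq_one_of_level_le`, Thm. 2.6 / appendix Thm. 5.2
first sentence (Cremona): the Manin constant of every optimal parametrisation datum at level
`≤ 130000` is `±1`): on the optimal member of conductor `N ≤ 130000`, `X2.CellCNonsplitGV` ∧ ONE
engine-currency Riemann sum ⟹ `BSD(E,p)`; here `ϖ = 1`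
(`varpi_eq_one_of_optimal_of_abs_maninConstant_eq_one`). CONDITIONAL; nothing booked.
[cite: AgasheRibetStein2006, Thm. 2.6 and appendix Thm. 5.2 (p. 633)] [cite: Disegni2020, Thm. 1 (§1.2)] -/
theorem bsdp_of_cellCNonsplitGV_of_optimal_of_level_le_of_thm1_of_neronRiemannSum_lt
    (h26 : cremona_abs_maninConstant_eq_one_of_level_le)
    (hD : thm1_padicBSD_rankOne_multiplicative) (hGV : lambdaMu_multiplicative_of_gvPar)
    (hWu : thm16_charIdeal_dvd_multiplicative_of_reducible) (hJn : thm61_nonsplitMultiplicative)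
    (hHn : exists_isMultCanonical) (hGZK : rank_eq_analyticRank_of_analyticRank_le_one)
    (hpar : nonempty_modularParametrizationData) (hc : CellCNonsplitGV W p)
    (hopt : ∀ z ∈ D.L.lattice, ∃ w ∈ periodLattice D.f, z = D.c * w) (hN : N ≤ 130000)
    (hκ : ‖((κ : ℚ) : ℚ_[p])‖ = 1) (hϖ : (ϖ : ℝ) * W.realPeriodRat = plusPeriod D.f)
    (hx : ∀ r, x r = κ * ϖ * ratPlusSymbol D.f r)
    {n : ℕ} (hlt : (p : ℝ) ^ (-n : ℤ) < ‖RSx 1 n‖) : BSDp W p :=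
  bsdp_of_cellCNonsplitGV_of_optimal_of_thm1_of_neronRiemannSum_lt W p D hRSx hD hGV hWu hJn hHn hGZK
    hpar hc hopt (not_dvd_maninConstant_of_level_le h26 W D hopt hN Fact.out) hκ hϖ hx hlt

/-- **The same, with the Manin constant from Mazur 1978, Cor. 4.1** (named fact
`mazur_not_dvd_maninConstant_of_odd`: for the optimal curve and an odd `p` with `p² ∤ N`, `p ∤ c`):
at a MULTIPLICATIVE prime `p² ∤ N` is automatic (`a_p = ±1`,
`not_sq_dvd_level_of_hasMultiplicativeReductionAtPrime`) and `p ≠ 2` is part of X2, so on the optimal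
member of ANY conductor `X2.CellCNonsplitGV` ∧ ONE engine-currency Riemann sum ⟹ `BSD(E,p)`.
CONDITIONAL; nothing booked. [cite: Mazur1978, Cor. 4.1] [cite: Disegni2020, Thm. 1 (§1.2)] -/
theorem bsdp_of_cellCNonsplitGV_of_optimal_of_mazur_of_thm1_of_neronRiemannSum_lt
    (hM : mazur_not_dvd_maninConstant_of_odd)
    (hD : thm1_padicBSD_rankOne_multiplicative) (hGV : lambdaMu_multiplicative_of_gvPar)
    (hWu : thm16_charIdeal_dvd_multiplicative_of_reducible) (hJn : thm61_nonsplitMultiplicative)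
    (hHn : exists_isMultCanonical) (hGZK : rank_eq_analyticRank_of_analyticRank_le_one)
    (hpar : nonempty_modularParametrizationData) (hc : CellCNonsplitGV W p)
    (hopt : ∀ z ∈ D.L.lattice, ∃ w ∈ periodLattice D.f, z = D.c * w)
    (hκ : ‖((κ : ℚ) : ℚ_[p])‖ = 1) (hϖ : (ϖ : ℝ) * W.realPeriodRat = plusPeriod D.f)
    (hx : ∀ r, x r = κ * ϖ * ratPlusSymbol D.f r)
    {n : ℕ} (hlt : (p : ℝ) ^ (-n : ℤ) < ‖RSx 1 n‖) : BSDp W p :=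
  bsdp_of_cellCNonsplitGV_of_optimal_of_thm1_of_neronRiemannSum_lt W p D hRSx hD hGV hWu hJn hHn hGZK
    hpar hc hopt
    (hM W D hopt p Fact.out hc.1.2.1
      (not_sq_dvd_level_of_hasMultiplicativeReductionAtPrime hc.1.2.2.2 D.isNewformOf))
    hκ hϖ hx hlt

/-- **X2c ∧ ¬split ∧ Mazur's MC at the pair ∧ OPTIMAL member ∧ ONE engine-currency Riemann sum ⟹
`BSD(E,p)`** — the other parity (`X2.CellCNonsplitNotGV`, route G per pair) in the engines' currency:
p291694's `bsdp_of_cellC_of_not_split_of_mazurMainConjectureAt_of_thm1_of_riemannSum_lt` with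
`‖RSx 1 n‖ = ‖RS 1 n‖` on the optimal member (`p ∤ c`). CONDITIONAL; nothing booked.
[cite: Disegni2020, Thm. 1 (§1.2)] [cite: SteinWuthrich2013, Thm. 6.1 (p. 20), §3, §4.2]
[cite: CremonaAlgorithms1997, §2.8 (p. 26)] -/
theorem bsdp_of_cellC_of_not_split_of_mazurMainConjectureAt_of_optimal_of_thm1_of_neronRiemannSum_lt
    (hD : thm1_padicBSD_rankOne_multiplicative) (hJn : thm61_nonsplitMultiplicative)
    (hHn : exists_isMultCanonical) (hGZK : rank_eq_analyticRank_of_analyticRank_le_one)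
    (hpar : nonempty_modularParametrizationData)
    (hc : CellC W p) (hns : ¬ W.HasSplitMultiplicativeReductionAtPrime p)
    (hMC : MazurMainConjectureAt W p)
    (hopt : ∀ z ∈ D.L.lattice, ∃ w ∈ periodLattice D.f, z = D.c * w)
    (hcp : ¬ (p : ℤ) ∣ D.maninConstant) (hκ : ‖((κ : ℚ) : ℚ_[p])‖ = 1)
    (hϖ : (ϖ : ℝ) * W.realPeriodRat = plusPeriod D.f) (hx : ∀ r, x r = κ * ϖ * ratPlusSymbol D.f r)
    {n : ℕ} (hlt : (p : ℝ) ^ (-n : ℤ) < ‖RSx 1 n‖) : BSDp W p := by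
  obtain ⟨RS, hRS, -⟩ := exists_riemannSumNonsplit_eq_mul (p := p) D.f hx hRSx
  have hnorm : ‖RSx 1 n‖ = ‖RS 1 n‖ :=
    norm_riemannSumNonsplit_eq_of_optimal D hopt hcp hκ hϖ hx hRSx hRS 1 n
  rw [hnorm] at hlt
  exact bsdp_of_cellC_of_not_split_of_mazurMainConjectureAt_of_thm1_of_riemannSum_lt W p D hRS hD hJn
    hHn hGZK hpar hc hns hMC hlt

end Consumers

end Summit.BirchSwinnertonDyer.Rank1Residual.X2

end
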